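import Summits.AtomisticToContinuum.Crystallization.Theorems.SummedShellPricing.Negative.PricingClause

/-!
# Negative knowledge for crux `SpectralChargeLedger.SummedShellPricing` (stmt-AtomisticToContinuum-17044), III:
# the cell is pinned; load-bearing hypotheses; what K1 forces on the ground states

Refuter file (`--supports stmt-AtomisticToContinuum-17044`; cdisprove seat, cycle 1; mirrors §3
(cells), §4, §5 of `Cruxes/SummedShellPricing/Disproof.lean`; notations of part I).  All `[folklore]`.

* `not_good_of_good_of_cells`, `not_pricingClause_two_cells`, `not_summedShellPricing_forall_cells` —
  the strengthening "for ALL cells of the box" is FALSE: the ideal cells `a₀ = 47/50` and `a₀ = 1`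
  cannot both be priced at `τ = 1/50` (no shell is `τ`-close to both reference shells; ground
  states have excess `o(N)`).  The `∃ (a₀, h₀)` of K1 is pinned by the ground states.
* `summedShellPricing_false_without_bad` (`B ⊆ bad` dropped ⇒ false),
  `summedShellPricing_false_without_separation` (separation dropped entirely ⇒ false, through the
  junk value `V_LJ(0) = 0` on the doubled ground state); `summedShellPricing_iff_noUpperTau`
  (`τ ≤ 1` is cosmetic).
* `card_bad_le_of_pricingClause` — K1 at a cell forces, for every `ε > 0`, eventually
  `#bad_τ(x^N) ≤ ε N` in every ground state: K1 contains first-shell crystallization onto ONE cell.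
-/

noncomputable section

namespace Summit.AtomisticToContinuum.Crystallization.Theorems.SummedShellPricing.Negative

open scoped BigOperators
open Literature.MathematicalPhysics.StatisticalMechanics
open Summit.AtomisticToContinuum.Crystallization.Theorems.ChargedEnergyGapNegative
  (E3 eStar card_mul_eStar_le crysEnergyLimit groundStateEnergy_nonpos)
open Summit.AtomisticToContinuum.Crystallization.Theorems.OneMultiplierPricing.Negative.BarlowShellDilation
open Summit.AtomisticToContinuum.Crystallization.Theses.SpectralChargeLedger (SummedShellPricing)

/-- **Two cells cannot both be priced at one site**: if the reference shells of cell 1 have norms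
`≤ 1.01 a₁ < a₂ − 2τ` and `a₂ + τ < 13/10·a₁`, a site `τ`-good for cell `(a₁,h₁)` is `τ`-bad for
cell `(a₂,h₂)` (the point `(a₂,0,0)` of the second reference shell has a preimage of norm
`≥ a₂ − τ`, which lies in the first shell and is therefore of norm `≤ 1.01 a₁ + τ`). [folklore] -/
theorem not_good_of_good_of_cells {a₁ h₁ a₂ h₂ τ : ℝ} (ha₁ : 47 / 50 ≤ a₁)
    (hh₁ : |h₁ - a₁ * Real.sqrt (2 / 3)| ≤ a₁ / 100) (ha₂ : 0 < a₂)
    (hgap : 101 / 100 * a₁ + 2 * τ < a₂) (hfit : a₂ + τ < 13 / 10 * a₁)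
    {N : ℕ} {y : Fin N → E3} {i : Fin N} (hg₁ : Good⟪a₁, h₁, y, i, τ⟫) : ¬ Good⟪a₂, h₂, y, i, τ⟫ := by
  rintro ⟨A₂, hm₂⟩
  obtain ⟨A₁, hm₁⟩ := hg₁
  have hρ₁ : ∀ p : E3, (p ∈ {p : E3 | p ∈ hcpStacking a₁ h₁ ∧ p ≠ 0 ∧ ‖p‖ < 13 / 10 * a₁} ∨
      p ∈ {p : E3 | p ∈ fccStacking a₁ h₁ ∧ p ≠ 0 ∧ ‖p‖ < 13 / 10 * a₁}) → ‖p‖ ≤ 101 / 100 * a₁ :=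
    fun p hp => (norm_le_rho_of_mem ha₁ hh₁ hp).trans (rho_le ha₁ hh₁)
  -- from the second matching: a shell point `t` with `a₂ - τ ≤ ‖t - y i‖ ≤ a₂ + τ`
  have key₂ : ∀ T : Set E3, (∃ p ∈ T, ‖p‖ = a₂) →
      (∃ e : ↥{z : E3 | z ∈ Set.range y ∧ z ≠ y i ∧ dist z (y i) < 13 / 10 * a₂} ≃ ↥T, ∀ t : ↥{z : E3 | z ∈ Set.range y ∧ z ≠ y i ∧ dist z (y i) < 13 / 10 * a₂}, dist ((t : E3) - y i) (A₂ ((e t : ↥T) : E3)) ≤ τ) →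
      ∃ t : E3, t ∈ Set.range y ∧ t ≠ y i ∧ a₂ - τ ≤ ‖t - y i‖ ∧ ‖t - y i‖ ≤ a₂ + τ := by
    rintro T ⟨p₀, hp₀, hn⟩ ⟨e, he⟩
    have h1 : dist ((e.symm ⟨p₀, hp₀⟩ : E3) - y i) (A₂ p₀) ≤ τ := by
      simpa using he (e.symm ⟨p₀, hp₀⟩)
    rw [dist_eq_norm] at h1
    have hAp : ‖A₂ p₀‖ = a₂ := by rw [LinearIsometry.norm_map, hn]
    obtain ⟨hr, hne, -⟩ := (e.symm ⟨p₀, hp₀⟩).2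
    refine ⟨_, hr, hne, ?_, ?_⟩
    · have h2 := norm_sub_norm_le (A₂ p₀) ((e.symm ⟨p₀, hp₀⟩ : E3) - y i)
      have h3 : ‖A₂ p₀ - ((e.symm ⟨p₀, hp₀⟩ : E3) - y i)‖ = ‖(e.symm ⟨p₀, hp₀⟩ : E3) - y i - A₂ p₀‖ :=
        norm_sub_rev _ _
      linarith
    · have h2 := norm_sub_norm_le ((e.symm ⟨p₀, hp₀⟩ : E3) - y i) (A₂ p₀)
      linarith
  -- from the first matching: every point of the first shell has `‖t - y i‖ ≤ 1.01 a₁ + τ`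
  have key₁ : ∀ T : Set E3, (∀ p ∈ T, ‖p‖ ≤ 101 / 100 * a₁) →
      (∃ e : ↥{z : E3 | z ∈ Set.range y ∧ z ≠ y i ∧ dist z (y i) < 13 / 10 * a₁} ≃ ↥T, ∀ t : ↥{z : E3 | z ∈ Set.range y ∧ z ≠ y i ∧ dist z (y i) < 13 / 10 * a₁}, dist ((t : E3) - y i) (A₁ ((e t : ↥T) : E3)) ≤ τ) →
      ∀ t : ↥{z : E3 | z ∈ Set.range y ∧ z ≠ y i ∧ dist z (y i) < 13 / 10 * a₁}, ‖(t : E3) - y i‖ ≤ 101 / 100 * a₁ + τ := by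
    rintro T hT ⟨e, he⟩ t
    have h1 := he t
    rw [dist_eq_norm] at h1
    have h2 : ‖A₁ ((e t : ↥T) : E3)‖ ≤ 101 / 100 * a₁ := by
      rw [LinearIsometry.norm_map]; exact hT _ (e t).2
    have h3 := norm_sub_norm_le ((t : E3) - y i) (A₁ ((e t : ↥T) : E3))
    linarith
  obtain ⟨t, hr, hne, hlo, hhi⟩ : ∃ t : E3, t ∈ Set.range y ∧ t ≠ y i ∧
      a₂ - τ ≤ ‖t - y i‖ ∧ ‖t - y i‖ ≤ a₂ + τ := by
    rcases hm₂ with hm | hm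
    · exact key₂ _ (exists_mem_norm_eq_a ha₂ alternatingHagg) hm
    · exact key₂ _ (exists_mem_norm_eq_a ha₂ constHagg) hm
  have ht : t ∈ {z : E3 | z ∈ Set.range y ∧ z ≠ y i ∧ dist z (y i) < 13 / 10 * a₁} := ⟨hr, hne, by rw [dist_eq_norm]; linarith⟩
  have hup : ‖t - y i‖ ≤ 101 / 100 * a₁ + τ := by
    rcases hm₁ with hm | hm
    · exact key₁ _ (fun p hp => hρ₁ p (Or.inl hp)) hm ⟨t, ht⟩
    · exact key₁ _ (fun p hp => hρ₁ p (Or.inr hp)) hm ⟨t, ht⟩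
  linarith

/-- **Two cells cannot both satisfy the pricing clause** (at any positive prices): the ground
states would have to be `τ`-good at almost every site for BOTH, and no site is good for both.
[folklore] -/
theorem not_pricingClause_two_cells {δ : ℝ}
    (hδGS : ∀ (N : ℕ) (x : Fin N → E3), IsGroundState lennardJones x →
      ∀ i j : Fin N, i ≠ j → δ ≤ dist (x i) (x j))
    {a₁ h₁ a₂ h₂ τ κ₁ κ₂ : ℝ} (ha₁ : 47 / 50 ≤ a₁) (hh₁ : |h₁ - a₁ * Real.sqrt (2 / 3)| ≤ a₁ / 100)
    (ha₂ : 0 < a₂) (hgap : 101 / 100 * a₁ + 2 * τ < a₂) (hfit : a₂ + τ < 13 / 10 * a₁)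
    (hκ₁ : 0 < κ₁) (hκ₂ : 0 < κ₂)
    (hP₁ : PC⟪δ, a₁, h₁, τ, κ₁⟫) (hP₂ : PC⟪δ, a₂, h₂, τ, κ₂⟫) : False := by
  classical
  set m : ℝ := min κ₁ κ₂ with hm
  have hm0 : 0 < m := lt_min hκ₁ hκ₂
  have hm1 : m ≤ κ₁ := min_le_left _ _
  have hm2 : m ≤ κ₂ := min_le_right _ _
  set θ : ℝ := m / 4 with hθ
  have hθ0 : 0 < θ := by positivity
  have hEL : Filter.Tendsto (fun N : ℕ => groundStateEnergy lennardJones 3 N / (N : ℝ)) Filter.atTop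
      (nhds eStar) := crysEnergyLimit
  have hev1 : ∀ᶠ N : ℕ in Filter.atTop, groundStateEnergy lennardJones 3 N / (N : ℝ) < eStar + θ :=
    (tendsto_order.1 hEL).2 _ (lt_add_of_pos_right _ hθ0)
  obtain ⟨N, hN1, hN3⟩ := (hev1.and (Filter.eventually_ge_atTop 1)).exists
  have hNpos : (0 : ℝ) < N := by exact_mod_cast hN3
  have hEup : groundStateEnergy lennardJones 3 N < (eStar + θ) * N := (div_lt_iff₀ hNpos).1 hN1
  obtain ⟨x, hx⟩ := LennardJonesGroundStatesExist_holds N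
  have hsep := hδGS N x hx
  set B₁ : Finset (Fin N) := Finset.univ.filter (fun i : Fin N => ¬ Good⟪a₁, h₁, x, i, τ⟫) with hB₁
  set B₂ : Finset (Fin N) := Finset.univ.filter (fun i : Fin N => ¬ Good⟪a₂, h₂, x, i, τ⟫) with hB₂
  have hS1 := hP₁ N x hsep B₁ (fun i hi => (Finset.mem_filter.1 hi).2)
  have hS2 := hP₂ N x hsep B₂ (fun i hi => (Finset.mem_filter.1 hi).2)
  rw [hx.2] at hS1 hS2
  have hcover : (Finset.univ : Finset (Fin N)) ⊆ B₁ ∪ B₂ := by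
    intro i _
    rw [Finset.mem_union, hB₁, hB₂, Finset.mem_filter, Finset.mem_filter]
    by_cases hg : Good⟪a₁, h₁, x, i, τ⟫
    · exact Or.inr ⟨Finset.mem_univ _, not_good_of_good_of_cells ha₁ hh₁ ha₂ hgap hfit hg⟩
    · exact Or.inl ⟨Finset.mem_univ _, hg⟩
  have hcount : (N : ℝ) ≤ (B₁.card : ℝ) + (B₂.card : ℝ) := by
    have h1 := (Finset.card_le_card hcover).trans (Finset.card_union_le _ _)
    rw [Finset.card_univ, Fintype.card_fin] at h1
    exact_mod_cast h1
  clear_value B₁ B₂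
  clear hcover hB₁ hB₂ hP₁ hP₂
  have hb1 : m * (B₁.card : ℝ) ≤ κ₁ * (B₁.card : ℝ) := mul_le_mul_of_nonneg_right hm1 (Nat.cast_nonneg _)
  have hb2 : m * (B₂.card : ℝ) ≤ κ₂ * (B₂.card : ℝ) := mul_le_mul_of_nonneg_right hm2 (Nat.cast_nonneg _)
  have hsum : m * (N : ℝ) < 2 * θ * N := by
    have := mul_le_mul_of_nonneg_left hcount hm0.le
    nlinarith [this, hb1, hb2, hS1, hS2, hEup]
  have : m < 2 * θ := lt_of_mul_lt_mul_right hsum hNpos.le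
  rw [hθ] at this
  linarith

/-- **STRENGTHENING 4 refuted — the crux for EVERY cell of the box (`∀ a₀ h₀` instead of
`∃ a₀ h₀`) is false: the cell is pinned, not free.**  The ideal cells `(47/50, 47/50·√(2/3))` and
`(1, √(2/3))` (both in the box) cannot both be priced at `τ = 1/50`
(`not_pricingClause_two_cells`).  So any proof of K1 must IDENTIFY the cell from the ground states
(it is forced to be their asymptotic first-shell cell, `card_bad_le_of_pricingClause`); K1 is not
soft in `(a₀, h₀)`. [folklore] -/
theorem not_summedShellPricing_forall_cells :
    ¬ (∀ δ : ℝ, 0 < δ → ∀ a₀ h₀ : ℝ, 47 / 50 ≤ a₀ → a₀ ≤ 1 → |h₀ - a₀ * Real.sqrt (2 / 3)| ≤ a₀ / 100 →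
      ∀ τ : ℝ, 0 < τ → τ ≤ 1 → ∃ κ : ℝ, 0 < κ ∧ PC⟪δ, a₀, h₀, τ, κ⟫) := by
  intro H
  obtain ⟨δ, hδ, hGS⟩ := LennardJonesMinimalDistance_holds
  have hb₁ : |47 / 50 * Real.sqrt (2 / 3) - 47 / 50 * Real.sqrt (2 / 3)| ≤ (47 / 50 : ℝ) / 100 := by
    rw [sub_self, abs_zero]; norm_num
  have hb₂ : |Real.sqrt (2 / 3) - 1 * Real.sqrt (2 / 3)| ≤ (1 : ℝ) / 100 := by
    rw [one_mul, sub_self, abs_zero]; norm_num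
  obtain ⟨κ₁, hκ₁, hP₁⟩ := H δ hδ (47 / 50) (47 / 50 * Real.sqrt (2 / 3)) le_rfl (by norm_num) hb₁
    (1 / 50) (by norm_num) (by norm_num)
  obtain ⟨κ₂, hκ₂, hP₂⟩ := H δ hδ 1 (Real.sqrt (2 / 3)) (by norm_num) le_rfl hb₂
    (1 / 50) (by norm_num) (by norm_num)
  exact not_pricingClause_two_cells hGS le_rfl hb₁ one_pos (by norm_num) (by norm_num) hκ₁ hκ₂ hP₁ hP₂

/-! ## §4 Load-bearing hypotheses -/

/-- **`B ⊆ bad` is load-bearing**: the crux with the restriction `B ⊆ bad` DROPPED (every site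
priced) is false — the excess of ground states is `o(N)`, so no extensive set of sites can be
priced. [folklore] -/
theorem summedShellPricing_false_without_bad :
    ¬ (∀ δ : ℝ, 0 < δ → ∃ a₀ h₀ : ℝ, 47 / 50 ≤ a₀ ∧ a₀ ≤ 1 ∧ |h₀ - a₀ * Real.sqrt (2 / 3)| ≤ a₀ / 100 ∧
      ∀ τ : ℝ, 0 < τ → τ ≤ 1 → ∃ κ : ℝ, 0 < κ ∧
        ∀ (N : ℕ) (y : Fin N → E3), (∀ i j : Fin N, i ≠ j → δ ≤ dist (y i) (y j)) →
          ∀ B : Finset (Fin N),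
            κ * (B.card : ℝ) ≤ interactionEnergy lennardJones y - (N : ℝ) * eStar) := by
  intro H
  obtain ⟨δ, hδ, hGS⟩ := LennardJonesMinimalDistance_holds
  obtain ⟨a₀, h₀, -, -, -, hP⟩ := H δ hδ
  obtain ⟨κ, hκ, hP1⟩ := hP 1 one_pos le_rfl
  have hEL : Filter.Tendsto (fun N : ℕ => groundStateEnergy lennardJones 3 N / (N : ℝ)) Filter.atTop
      (nhds eStar) := crysEnergyLimit
  have hev1 : ∀ᶠ N : ℕ in Filter.atTop, groundStateEnergy lennardJones 3 N / (N : ℝ) < eStar + κ / 2 :=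
    (tendsto_order.1 hEL).2 _ (lt_add_of_pos_right _ (half_pos hκ))
  obtain ⟨N, hN1, hN3⟩ := (hev1.and (Filter.eventually_ge_atTop 1)).exists
  have hNpos : (0 : ℝ) < N := by exact_mod_cast hN3
  have hEup : groundStateEnergy lennardJones 3 N < (eStar + κ / 2) * N := (div_lt_iff₀ hNpos).1 hN1
  obtain ⟨x, hx⟩ := LennardJonesGroundStatesExist_holds N
  have h := hP1 N x (hGS N x hx) Finset.univ
  rw [Finset.card_univ, Fintype.card_fin, hx.2] at h
  nlinarith

/-- **Separation (or at least injectivity) is load-bearing — but only through the junk value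
`V_LJ(0) = 0`**: the crux with the separation hypothesis DROPPED ENTIRELY (`y` arbitrary, possibly
with coincident points; the `∀ δ` prefix then binds nothing and is omitted) is false: the DOUBLED ground state `x ⧺ x` (every point twice) has energy `4 E(N)` (the `N`
coincident pairs contribute `V(0) = 0` instead of `+∞`) against the floor `2N e⋆`, and
`4 E(N) − 2N e⋆ → 2N e⋆ < 0`; already `B = ∅` fails.  (The honest reading — injective but not
separated — is believed EQUIVALENT to K1: the landed `stub_sepReduction` removes separation down to
every `δ > 0` by closest-pair deletion, and the same deletion handles merely injective `y`.)
[folklore] -/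
theorem summedShellPricing_false_without_separation :
    ¬ (∃ a₀ h₀ : ℝ, 47 / 50 ≤ a₀ ∧ a₀ ≤ 1 ∧ |h₀ - a₀ * Real.sqrt (2 / 3)| ≤ a₀ / 100 ∧
      ∀ τ : ℝ, 0 < τ → τ ≤ 1 → ∃ κ : ℝ, 0 < κ ∧
        ∀ (N : ℕ) (y : Fin N → E3) (B : Finset (Fin N)), (∀ i ∈ B, ¬ Good⟪a₀, h₀, y, i, τ⟫) →
          κ * (B.card : ℝ) ≤ interactionEnergy lennardJones y - (N : ℝ) * eStar) := by
  rintro ⟨a₀, h₀, -, -, -, hP⟩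
  obtain ⟨κ, -, hP1⟩ := hP 1 one_pos le_rfl
  have he : 0 < -eStar := neg_eStar_pos
  have hEL : Filter.Tendsto (fun N : ℕ => groundStateEnergy lennardJones 3 N / (N : ℝ)) Filter.atTop
      (nhds eStar) := crysEnergyLimit
  have hev1 : ∀ᶠ N : ℕ in Filter.atTop,
      groundStateEnergy lennardJones 3 N / (N : ℝ) < eStar + (-eStar / 4) :=
    (tendsto_order.1 hEL).2 _ (lt_add_of_pos_right _ (by positivity))
  obtain ⟨N, hN1, hN3⟩ := (hev1.and (Filter.eventually_ge_atTop 1)).exists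
  have hNpos : (0 : ℝ) < N := by exact_mod_cast hN3
  have hEup : groundStateEnergy lennardJones 3 N < (eStar + (-eStar / 4)) * N := (div_lt_iff₀ hNpos).1 hN1
  obtain ⟨x, hx⟩ := LennardJonesGroundStatesExist_holds N
  have h := hP1 (N + N) (Fin.append x x) ∅ (fun i hi => absurd hi (Finset.notMem_empty i))
  rw [Finset.card_empty, Nat.cast_zero, mul_zero, interactionEnergy_append lennardJones lennardJones_zero,
    ← two_mul_interactionEnergy_eq_sum_sum lennardJones lennardJones_zero, hx.2] at h
  push_cast at h
  nlinarith

/-- **`τ ≤ 1` is NOT load-bearing** (cosmetic; the crux with the upper bound dropped is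
EQUIVALENT): goodness is an up-set in `τ`, so `κ(1)` serves every
`τ > 1`. Likewise `∀ δ > 0` may be replaced by `δ = 1/3` (landed `stub_sepReduction`, p166632).
[folklore] -/
theorem summedShellPricing_iff_noUpperTau :
    SummedShellPricing ↔
      (∀ δ : ℝ, 0 < δ → ∃ a₀ h₀ : ℝ, 47 / 50 ≤ a₀ ∧ a₀ ≤ 1 ∧ |h₀ - a₀ * Real.sqrt (2 / 3)| ≤ a₀ / 100 ∧
        ∀ τ : ℝ, 0 < τ → ∃ κ : ℝ, 0 < κ ∧ PC⟪δ, a₀, h₀, τ, κ⟫) := by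
  rw [summedShellPricing_iff]
  constructor
  · intro H δ hδ
    obtain ⟨a₀, h₀, ha, ha', hh, hP⟩ := H δ hδ
    refine ⟨a₀, h₀, ha, ha', hh, fun τ hτ => ?_⟩
    rcases le_or_gt τ 1 with h1 | h1
    · exact hP τ hτ h1
    · obtain ⟨κ, hκ, hP1⟩ := hP 1 one_pos le_rfl
      exact ⟨κ, hκ, pricingClause_mono_tau h1.le hP1⟩
  · intro H δ hδ
    obtain ⟨a₀, h₀, ha, ha', hh, hP⟩ := H δ hδ
    exact ⟨a₀, h₀, ha, ha', hh, fun τ hτ _ => hP τ hτ⟩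

/-! ## §5 What K1 forces on the ground states (a positive consequence, for provers) -/

/-- **K1 at a cell `c` contains first-shell crystallization onto `c`**: if the pricing clause holds
at `(a₀, h₀, τ)` with some `κ > 0` (and ground states are `δ`-separated), then for every `ε > 0`,
eventually in `N`, every ground state has at most `ε N` sites whose `13/10·a₀`-shell is not
`τ`-matched to the hcp/fcc 12-shell of THAT cell.  With `not_summedShellPricing_forall_cells`: the
`∃ (a₀,h₀)` of K1 can only be the exact asymptotic cell of the Lennard-Jones ground states, for
every `τ` simultaneously — so a proof of K1 proves in passing that such a cell exists (one in-layer
spacing, ONE interlayer gap serving both letters). [folklore] -/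
theorem card_bad_le_of_pricingClause {δ : ℝ}
    (hδGS : ∀ (N : ℕ) (x : Fin N → E3), IsGroundState lennardJones x →
      ∀ i j : Fin N, i ≠ j → δ ≤ dist (x i) (x j))
    {a₀ h₀ τ κ : ℝ} (hκ : 0 < κ) (hP : PC⟪δ, a₀, h₀, τ, κ⟫) {ε : ℝ} (hε : 0 < ε) :
    ∀ᶠ N : ℕ in Filter.atTop, ∀ x : Fin N → E3, IsGroundState lennardJones x →
      ∀ B : Finset (Fin N), (∀ i ∈ B, ¬ Good⟪a₀, h₀, x, i, τ⟫) → (B.card : ℝ) ≤ ε * N := by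
  have hEL : Filter.Tendsto (fun N : ℕ => groundStateEnergy lennardJones 3 N / (N : ℝ)) Filter.atTop
      (nhds eStar) := crysEnergyLimit
  have hev1 : ∀ᶠ N : ℕ in Filter.atTop, groundStateEnergy lennardJones 3 N / (N : ℝ) < eStar + κ * ε :=
    (tendsto_order.1 hEL).2 _ (lt_add_of_pos_right _ (mul_pos hκ hε))
  filter_upwards [hev1, Filter.eventually_ge_atTop 1] with N hN1 hN3 x hx B hB
  have hNpos : (0 : ℝ) < N := by exact_mod_cast hN3
  have hEup : groundStateEnergy lennardJones 3 N < (eStar + κ * ε) * N := (div_lt_iff₀ hNpos).1 hN1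
  have h := hP N x (hδGS N x hx) B hB
  rw [hx.2] at h
  have hlt : κ * (B.card : ℝ) < κ * (ε * N) := by nlinarith
  exact (lt_of_mul_lt_mul_left hlt hκ.le).le

end Summit.AtomisticToContinuum.Crystallization.Theorems.SummedShellPricing.Negative

end
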